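import Literature.AlgebraicGeometry.AbelianSchemes.AbelianSchemeFibreHom
import Literature.AlgebraicGeometry.Motives.AbelianVarietyTranslationInvariantAmple
import HarnessLib

/-!
# Pull-back of a rigidified fibrewise-`Pic⁰` family along a HOMOMORPHISM of abelian schemes

Layer `Literature/AlgebraicGeometry/AbelianSchemes`, namespace `Literature.AlgebraicGeometry.AbelianSchemes.AbelianSchemeOver`
(+ one dot-notation extension of ★ `AbelianVarieties.IsHomogeneous`).  ONE definition with body (`RigidifiedLineBundle.comapHom`,
a construction) + one `abbrev` (`baseChangeHom`, plumbing) — no `def … : Prop`, no named fact, no instance — and theorems.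

★ `RigidifiedLineBundle.comap u` (`RigidifiedLineBundleComap`) is the pull-back of a rigidified family on `A_T` along a change
of the BASE `u : T′ → T`.  This file is the pull-back along a change of the ABELIAN SCHEME: for a homomorphism of `S`-group schemes
`v : A → B` between abelian schemes over `S` ([MumfordFogartyKirwan1994] Ch. 6 §1 Def. 6.1, Cor. 6.4) and `f : T → S`, the base
change `v_T = v ×_S T : A_T → B_T` (Mathlib `(Over.pullback f).map v`, a homomorphism again since `Over.pullback f` is monoidal)
pulls a rigidified line bundle `ℒ` on `B_T` back to a rigidified line bundle `v_T^* ℒ` on `A_T`: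

* §0 `AbelianVarieties.IsHomogeneous.pullback_hom` — over a field, **homogeneity pulls back along homomorphisms of abelian
  varieties** (`t_P^* j^* E ≅ j^* t_{j(P)}^* E ≅ j^* E`, ★ `AbelianVariety.translation_comp_hom`; [MumfordAV1970] §8 (iv)).
* §1 `baseChangeHom v f := (Over.pullback f).map v : A_T ⟶ B_T` (abbrev, non-Prop plumbing), `isMonHom_baseChangeHom`,
  `unitSection_comp_baseChangeHom_left` — `ε_{A_T} ≫ v_T = ε_{B_T}` (`v_T` is a homomorphism).
* §2 **`RigidifiedLineBundle.comapHom v ℒ : A.RigidifiedLineBundle f`** — module `v_T^* ℒ`, rank one (★ `hasRank_pullback`),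
  rigidification `ε_{A_T}^* v_T^* ℒ ≅ (ε_{A_T} ≫ v_T)^* ℒ = ε_{B_T}^* ℒ ≅ 𝒪_T`; `comapHom_L` (rfl).
* §3 **`RigidifiedLineBundle.FibrewisePicZero.comapHom`** — `v_T^* ℒ` lies fibrewise in `Pic⁰` if `ℒ` does: on the geometric
  fibre at `t` it is `(v_T)_t^*` of the fibre of `ℒ` (★ `fibreHom`, ★ `fibreHom_toSchemeHom_fst`), and §0.

Cell `hodgecm-mathlib` (D-0151), HECKE-LINK H2 file (ii) «dual pair of the quotient `A/K`» (B-p20 (g9) hand 20:24:30Z / 20:29:27Z,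
census `CENSUS-H2-DualPairOfQuotient` §1): consumers D3b (`v = π : A/K → A`, the descended `[n]`) and D6 (u1) (`v = ψ : A → A/K`),
and the (β) polarisation pull-backs (B-p14 (g14)).  Books 0; HC_CM is proved only modulo the 7 printed citations until rung 0 closes.

## References
* [MilneAV2008] J. S. Milne, *Abelian Varieties* (v2.00, 2008), I §8 pp. 36–37 (rigidified families, `(1 × α)^*𝒫`).
* [MumfordAV1970] D. Mumford, *Abelian Varieties* (1970), §8 ((iv) ⇔ (i)) (`Pic⁰` = translation-invariant classes), §13 (p. 125).
* [MumfordFogartyKirwan1994] D. Mumford, J. Fogarty, F. Kirwan, *GIT* 3rd ed. (1994), Ch. 6 §1 Def. 6.1 (p. 115), Cor. 6.4 (p. 117).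
* [GortzWedhorn2020] U. Görtz, T. Wedhorn, *Algebraic Geometry I* (2nd ed. 2020), Section (4.7) (base change).
-/

set_option autoImplicit false

noncomputable section

universe u

open CategoryTheory CategoryTheory.Limits AlgebraicGeometry
open Literature.AlgebraicGeometry.Motives Literature.AlgebraicGeometry.Modules

/-! ## §0 Homogeneity pulls back along homomorphisms of abelian varieties -/

namespace Literature.AlgebraicGeometry.AbelianVarieties

/-- **Homogeneity pulls back along homomorphisms**: for a homomorphism `j : X → Y` of abelian varieties over `K` and a
homogeneous (translation-invariant) module `E` on `Y`, `j^*E` is homogeneous on `X` — `t_P^* j^* E ≅ (t_P ≫ j)^* E =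
(j ≫ t_{j(P)})^* E ≅ j^* t_{j(P)}^* E ≅ j^* E` (★ `AbelianVariety.translation_comp_hom`).  Dot-notation extension of ★
`AbelianVarieties.IsHomogeneous` declared from `AbelianSchemes/`. [cite: MumfordAV1970, §8 ((iv) ⇔ (i))] -/
theorem IsHomogeneous.pullback_hom {K : Type u} [Field K] {X Y : AbelianVariety K} (j : X ⟶ Y)
    {E : Y.X.left.Modules} (h : IsHomogeneous Y E) :
    IsHomogeneous X ((Scheme.Modules.pullback j.hom.hom.hom.left).obj E) := by
  intro P
  obtain ⟨i⟩ := h (P ≫ j.hom.hom.hom)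
  have e : (X.translation P).left ≫ j.hom.hom.hom.left =
      j.hom.hom.hom.left ≫ (Y.translation (P ≫ j.hom.hom.hom)).left := by
    rw [← Over.comp_left, AbelianVariety.translation_comp_hom, Over.comp_left]
  exact ⟨(Scheme.Modules.pullbackComp _ _).app E ≪≫ (Scheme.Modules.pullbackCongr e).app E ≪≫
    ((Scheme.Modules.pullbackComp _ _).app E).symm ≪≫ (Scheme.Modules.pullback j.hom.hom.hom.left).mapIso i⟩

end Literature.AlgebraicGeometry.AbelianVarieties

namespace Literature.AlgebraicGeometry.AbelianSchemes

namespace AbelianSchemeOver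

open Literature.AlgebraicGeometry.AbelianVarieties
open scoped MonObj

variable {S : Scheme.{u}} {A B : AbelianSchemeOver S} {T : Scheme.{u}}

/-! ## §1 The base change `v_T : A_T → B_T` of a homomorphism -/

section BaseChangeHom

variable (v : A.X ⟶ B.X) (f : T ⟶ S)

/-- **`v_T = v ×_S T : A_T → B_T`** — the base change of `v` as a morphism of the carriers of the base-changed abelian schemes
(Mathlib `(Over.pullback f).map v`; an `abbrev`, so that the group-object instances of `A_T`, `B_T` are found on its source and
target; non-Prop plumbing). [cite: GortzWedhorn2020, Section (4.7)] -/
abbrev baseChangeHom : (A.baseChange f).X ⟶ (B.baseChange f).X :=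
  (Over.pullback f).map v

/-- `v_T` is a homomorphism of `T`-group schemes when `v` is one (Mathlib: `Over.pullback f` is cartesian monoidal and maps
monoid morphisms to monoid morphisms — the ★ `Polarization.baseChange` device).  A theorem, not an instance.
[cite: MumfordFogartyKirwan1994, Ch. 6 §1 Corollary 6.4 (p. 117)] [cite: GortzWedhorn2020, Section (4.7)] -/
theorem isMonHom_baseChangeHom [IsMonHom v] : IsMonHom (baseChangeHom v f) :=
  Functor.map.instIsMonHom _ _ v

/-- **`ε_{A_T} ≫ v_T = ε_{B_T}`**: a homomorphism preserves unit sections. [cite: MumfordFogartyKirwan1994, Ch. 6 §1 Corollary 6.4 (p. 117)] -/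
@[reassoc]
theorem unitSection_comp_baseChangeHom_left [IsMonHom v] :
    (A.baseChange f).unitSection ≫ (baseChangeHom v f).left = (B.baseChange f).unitSection := by
  haveI := isMonHom_baseChangeHom v f
  change (η[(A.baseChange f).X]).left ≫ (baseChangeHom v f).left = (η[(B.baseChange f).X]).left
  rw [← Over.comp_left, IsMonHom.one_hom]

/-- `v_T` commutes with the projections: `v_T ≫ pr_B = pr_A ≫ v`. [cite: GortzWedhorn2020, Section (4.7)] -/
@[reassoc]
theorem baseChangeHom_left_comp_fst :
    (baseChangeHom v f).left ≫ pullback.fst B.X.hom f = pullback.fst A.X.hom f ≫ v.left := by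
  simp only [baseChangeHom, Over.pullback_map_left]
  erw [pullback.lift_fst]

end BaseChangeHom

/-! ## §2 The pull-back `v_T^* ℒ` as a rigidified line bundle on `A_T` -/

namespace RigidifiedLineBundle

/-- **`ℒ.comapHom v = v_T^* ℒ`** — the pull-back of a rigidified line bundle on `B_T` along the base change `v_T : A_T → B_T` of
a homomorphism `v : A → B`, rigidified by `ε_{A_T}^* v_T^* ℒ ≅ (ε_{A_T} ≫ v_T)^* ℒ = ε_{B_T}^* ℒ ≅ 𝒪_T`.
[cite: MilneAV2008, I §8 pp. 36–37] [cite: MumfordAV1970, §13 (p. 125)] -/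
def comapHom (v : A.X ⟶ B.X) [IsMonHom v] {f : T ⟶ S} (ℒ : B.RigidifiedLineBundle f) : A.RigidifiedLineBundle f where
  L := (Scheme.Modules.pullback (baseChangeHom v f).left).obj ℒ.L
  hasRank_one := hasRank_pullback _ ℒ.hasRank_one
  rigid := ℒ.rigid.map fun r =>
    (Scheme.Modules.pullbackComp _ _).app ℒ.L ≪≫
      (Scheme.Modules.pullbackCongr (unitSection_comp_baseChangeHom_left v f)).app ℒ.L ≪≫ r

/-- The module of `ℒ.comapHom v` is `v_T^* ℒ` (definitional). [cite: MilneAV2008, I §8 pp. 36–37] -/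
@[simp]
theorem comapHom_L (v : A.X ⟶ B.X) [IsMonHom v] {f : T ⟶ S} (ℒ : B.RigidifiedLineBundle f) :
    (ℒ.comapHom v).L = (Scheme.Modules.pullback (baseChangeHom v f).left).obj ℒ.L :=
  rfl

/-! ## §3 The fibrewise-`Pic⁰` condition pulls back along homomorphisms -/

/-- The geometric fibre of `v_T^* ℒ` at `t : Spec Ω → T` is the pull-back of the fibre of `ℒ` along the fibre homomorphism
`(v_T)_t : (A_T)_t → (B_T)_t` (★ `fibreHom`, ★ `fibreHom_toSchemeHom_fst`). [cite: MilneAV2008, I §8 pp. 36–37] -/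
theorem nonempty_fibreModule_comapHom_iso (v : A.X ⟶ B.X) [IsMonHom v] {f : T ⟶ S} (ℒ : B.RigidifiedLineBundle f)
    {Ω : Type u} [Field Ω] (t : Spec (.of Ω) ⟶ T) :
    haveI := isMonHom_baseChangeHom v f
    Nonempty ((ℒ.comapHom v).fibreModule t ≅
      (Scheme.Modules.pullback (AbelianVariety.Hom.toSchemeHom (fibreHom (baseChangeHom v f) t))).obj
        (ℒ.fibreModule t)) := by
  haveI := isMonHom_baseChangeHom v f
  have e : pullback.fst (A.baseChange f).X.hom t ≫ (baseChangeHom v f).left =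
      AbelianVariety.Hom.toSchemeHom (fibreHom (baseChangeHom v f) t) ≫ pullback.fst (B.baseChange f).X.hom t :=
    (fibreHom_toSchemeHom_fst (baseChangeHom v f) t).symm
  exact ⟨(Scheme.Modules.pullbackComp (pullback.fst (A.baseChange f).X.hom t) (baseChangeHom v f).left).app ℒ.L ≪≫
    (Scheme.Modules.pullbackCongr e).app ℒ.L ≪≫
    ((Scheme.Modules.pullbackComp (AbelianVariety.Hom.toSchemeHom (fibreHom (baseChangeHom v f) t))
      (pullback.fst (B.baseChange f).X.hom t)).app ℒ.L).symm⟩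

/-- **`v_T^* ℒ` lies fibrewise in `Pic⁰` if `ℒ` does** (`t_x^* (v_T)_t^* = (v_T)_t^* t_{(v_T)_t x}^*` on every geometric fibre:
§0 along the fibre homomorphism `(v_T)_t`). [cite: MumfordAV1970, §8 ((iv) ⇔ (i)) and §13 (p. 125)] [cite: MilneAV2008, I §8 pp. 36–37] -/
theorem FibrewisePicZero.comapHom (v : A.X ⟶ B.X) [IsMonHom v] {f : T ⟶ S} {ℒ : B.RigidifiedLineBundle f}
    (h : ℒ.FibrewisePicZero) : (ℒ.comapHom v).FibrewisePicZero := by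
  intro Ω _ _ t
  haveI := isMonHom_baseChangeHom v f
  obtain ⟨i⟩ := nonempty_fibreModule_comapHom_iso v ℒ t
  exact IsHomogeneous.of_iso i.symm ((h Ω t).pullback_hom _)

end RigidifiedLineBundle

end AbelianSchemeOver

end Literature.AlgebraicGeometry.AbelianSchemes

end
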